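import Mathlib
import Summits.ValiantsHypothesis.ValiantsHypothesis.Theorems.TriangularDimersDivisionEasy.Negative.Gadgets

/-!
# `TriangularDimersDivisionEasy` — negative lemma: VALIANT'S MONOTONE LOWER BOUND (division is load-bearing)

Crux `stmt-ValiantsHypothesis-5067` (`Theses.DivisionGap.TriangularDimersDivisionEasy`, route
DivisionGap).  Standing disprover (cdisprove gen 1), `Cruxes/TriangularDimersDivisionEasy/Disproof.lean`
§E, now closed: the crux with the division removed (`h` frozen to `1`) is FALSE.

* `monotone_lower_bound` — for even `n ≥ 64` and every `L ≤ (n - 60)/24`: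
  `T^L ≤ 4 · L₊(D_n) · (n²+1)² · (T-1)^L`, `T = 6^44`, i.e. `L₊(D_n) ≥ (T/(T-1))^{(n-60)/24} / (4(n²+1)²)`
  — an exponential `2^{Ω(n)}` lower bound for the monotone circuit complexity of the triangular-rhombus
  dimer polynomial in the crux's encoding (Valiant 1980, Thm 1, there for the triangle `G_n`).
  Proof: the tree's structure theorem (`ArithCircuit.exists_balanced_decomposition`, applicable since
  `D_n` is fully ordered, `isFullyOrdered_triPM`) writes `D_n` as `≤ 4 s (n²+1)²` balanced rectangles;
  each rectangle's support is at most a `((T-1)/T)^L` fraction of the dimer covers (`rect_card_le` with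
  the `L` far-apart mixed gadgets of `exists_gadgets`); supports add up.
* `not_monotoneEasyWithoutDivision` — hence `¬ ∃ c, ∀ n, L₊(D_n) ≤ 2^((log₂ n + c)^c)`: any proof of
  the crux must use the free factor `h` super-quasi-polynomially.
[cite: Valiant1980, §3 Thm 1]
-/

namespace Summit.ValiantsHypothesis.ValiantsHypothesis.Theorems.TriangularDimersDivisionEasy.Negative

open Literature.Computability.AlgebraicComplexity
open MvPolynomial
open scoped BigOperators NNReal

set_option linter.dupNamespace false

noncomputable section

open Classical

variable {n : ℕ}

/-! ## A dimer cover exists for even `n` -/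

/-- The partner column: `j ↦ j+1` for even `j`, `j ↦ j-1` for odd `j`. [folklore] -/
def partner (hn : Even n) (j : Fin n) : Fin n :=
  if h : (j : ℕ) % 2 = 0 then ⟨j + 1, by
    obtain ⟨k, hk⟩ := hn
    have := j.2
    omega⟩
  else ⟨j - 1, by have := j.2; omega⟩

/-- The partner of an even column is the next column. [folklore] -/
theorem partner_val_of_even (hn : Even n) {j : Fin n} (h : (j : ℕ) % 2 = 0) :
    ((partner hn j : Fin n) : ℕ) = (j : ℕ) + 1 := by
  unfold partner; rw [dif_pos h]

/-- The partner of an odd column is the previous column. [folklore] -/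
theorem partner_val_of_odd (hn : Even n) {j : Fin n} (h : ¬ (j : ℕ) % 2 = 0) :
    ((partner hn j : Fin n) : ℕ) = (j : ℕ) - 1 := by
  unfold partner; rw [dif_neg h]

/-- `partner` is an involution. [folklore] -/
theorem partner_partner (hn : Even n) (j : Fin n) : partner hn (partner hn j) = j := by
  apply Fin.ext
  by_cases h : (j : ℕ) % 2 = 0
  · have h1 := partner_val_of_even hn h
    have h2 : ¬ ((partner hn j : Fin n) : ℕ) % 2 = 0 := by rw [h1]; omega
    rw [partner_val_of_odd hn h2, h1]; omega
  · have h1 := partner_val_of_odd hn h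
    have h2 : ((partner hn j : Fin n) : ℕ) % 2 = 0 := by rw [h1]; omega
    rw [partner_val_of_even hn h2, h1]; omega

/-- `partner` has no fixed point. [folklore] -/
theorem partner_ne (hn : Even n) (j : Fin n) : partner hn j ≠ j := by
  intro heq
  have := congrArg Fin.val heq
  by_cases h : (j : ℕ) % 2 = 0
  · rw [partner_val_of_even hn h] at this; omega
  · rw [partner_val_of_odd hn h] at this; omega

/-- The "horizontal dominoes" cover `(i, j) ↦ (i, partner j)`. [folklore] -/
def rowCover (hn : Even n) : Vtx n → Vtx n := fun v => (v.1, partner hn v.2)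

/-- The horizontal-domino cover is a dimer cover of `R_n` for even `n`. [folklore] -/
theorem rowCover_mem_dimers (hn : Even n) : rowCover hn ∈ dimers n := by
  rw [dimers, Finset.mem_filter]
  refine ⟨Finset.mem_univ _, fun v => ?_⟩
  obtain ⟨i, j⟩ := v
  refine ⟨?_, ?_, ?_⟩
  · simp only [rowCover, partner_partner]
  · simp only [rowCover, ne_eq, Prod.mk.injEq, true_and]
    exact partner_ne hn j
  · simp only [rowCover, Adj]
    by_cases h : (j : ℕ) % 2 = 0
    · rw [partner_val_of_even hn h]; simp
    · rw [partner_val_of_odd hn h]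
      right; right; right; left
      constructor
      · trivial
      · have := j.2; omega

/-- For even `n` a dimer cover exists. [folklore] -/
theorem dimers_nonempty (hn : Even n) : (dimers n).Nonempty := ⟨_, rowCover_mem_dimers hn⟩

/-! ## Supports add up -/

/-- The support of a sum is covered by the supports of the summands. [folklore] -/
theorem card_support_list_sum_le (l : List (MvPolynomial (Var n) ℝ≥0)) :
    l.sum.support.card ≤ (l.map fun p => p.support.card).sum := by
  induction l with
  | nil => simp
  | cons p l ih =>
    rw [List.sum_cons, List.map_cons, List.sum_cons]
    calc (p + l.sum).support.card ≤ (p.support ∪ l.sum.support).card := Finset.card_le_card (support_add)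
      _ ≤ p.support.card + l.sum.support.card := Finset.card_union_le _ _
      _ ≤ p.support.card + (l.map fun p => p.support.card).sum := Nat.add_le_add_left ih _

/-- A list sum is at most its length times a common bound. [folklore] -/
theorem list_sum_le_length_mul {l : List ℕ} {B : ℕ} (h : ∀ x ∈ l, x ≤ B) : l.sum ≤ l.length * B := by
  induction l with
  | nil => simp
  | cons x l ih =>
    rw [List.sum_cons, List.length_cons]
    have h1 := h x List.mem_cons_self
    have h2 := ih fun y hy => h y (List.mem_cons_of_mem _ hy)
    nlinarith

/-! ## The lower bound -/

/-- **Valiant's monotone lower bound for the triangular rhombus, in the tree's encoding.**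
[cite: Valiant1980, §3 Thm 1] -/
theorem monotone_lower_bound (h64 : 64 ≤ n) (he : Even n) {L : ℕ} (hL : 24 * L + 60 ≤ n) :
    Tfib ^ L ≤ 4 * complexity (triPM n) * (n * n + 1) ^ 2 * (Tfib - 1) ^ L := by
  have hn : 0 < n := by omega
  -- an optimal fan-in-two circuit and its balanced decomposition
  obtain ⟨P, hP2, hPc, hPs⟩ := ArithCircuit.exists_computes_size_eq_complexity (triPM n)
  have hcard : Fintype.card (Vtx n) = n * n := by simp
  have h3 : 3 ≤ Fintype.card (Vtx n) := by rw [hcard]; nlinarith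
  obtain ⟨Ls, hlen, hsum, hterms⟩ :=
    ArithCircuit.exists_balanced_decomposition P hP2 hPc (isFullyOrdered_triPM n) h3
  rw [hcard, hPs] at hlen
  -- each rectangle is small
  have hrect : ∀ t ∈ Ls, Tfib ^ L * (t.2.1 * t.2.2).support.card ≤ (Tfib - 1) ^ L * (dimers n).card := by
    intro t ht
    obtain ⟨hoa, hob, hb1, hb2, hdom⟩ := hterms t ht
    rw [hcard] at hb1 hb2
    obtain ⟨G, hGlen, hGV, hGfar, hGmix⟩ := exists_gadgets hn t.1 (by omega) hb1 hb2
    -- truncate to exactly L gadgets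
    have hLle : L ≤ G.length := by omega
    set G' := G.take L with hG'
    have hG'len : G'.length = L := by rw [hG', List.length_take]; exact min_eq_left hLle
    have hsub : G'.Sublist G := List.take_sublist _ _
    have := rect_card_le hn t.1 hoa hob hdom G' (fun g hg => hGV g (hsub.subset hg)) (hGfar.sublist hsub)
      (fun g hg => hGmix g (hsub.subset hg))
    rw [hG'len] at this
    exact this
  -- supports add up to at least the number of covers
  have hcov : (dimers n).card ≤ (Ls.map fun t => (t.2.1 * t.2.2).support.card).sum := by
    rw [← card_support_triPM, ← hsum]
    have := card_support_list_sum_le (Ls.map fun t => t.2.1 * t.2.2)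
    rw [List.map_map] at this
    exact this
  have hpos : 0 < (dimers n).card := Finset.card_pos.2 (dimers_nonempty he)
  -- combine
  have key : Tfib ^ L * (dimers n).card ≤ Ls.length * ((Tfib - 1) ^ L * (dimers n).card) := by
    calc Tfib ^ L * (dimers n).card ≤ Tfib ^ L * (Ls.map fun t => (t.2.1 * t.2.2).support.card).sum :=
          Nat.mul_le_mul_left _ hcov
      _ = (Ls.map fun t => Tfib ^ L * (t.2.1 * t.2.2).support.card).sum := by
          rw [List.sum_map_mul_left]
      _ ≤ (Ls.map fun t => Tfib ^ L * (t.2.1 * t.2.2).support.card).length * ((Tfib - 1) ^ L * (dimers n).card) := by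
          apply list_sum_le_length_mul
          intro x hx
          rw [List.mem_map] at hx
          obtain ⟨t, ht, rfl⟩ := hx
          exact hrect t ht
      _ = Ls.length * ((Tfib - 1) ^ L * (dimers n).card) := by rw [List.length_map]
  have key2 : Tfib ^ L ≤ Ls.length * (Tfib - 1) ^ L := by
    have : Tfib ^ L * (dimers n).card ≤ (Ls.length * (Tfib - 1) ^ L) * (dimers n).card := by
      rw [mul_assoc]; exact key
    exact Nat.le_of_mul_le_mul_right this hpos
  calc Tfib ^ L ≤ Ls.length * (Tfib - 1) ^ L := key2
    _ ≤ (4 * complexity (triPM n) * (n * n + 1) ^ 2) * (Tfib - 1) ^ L := Nat.mul_le_mul_right _ hlen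

end

end Summit.ValiantsHypothesis.ValiantsHypothesis.Theorems.TriangularDimersDivisionEasy.Negative
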